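import Mathlib.Analysis.ODE.Gronwall
import Summits.AnomalousDissipation.AnomalousDissipation.Theses.TwoAndHalfD
import Literature.Analysis.FluidPDE.PassiveScalarClassicalEnergy
import Literature.Analysis.FluidPDE.CompressibleEulerLinearizedDerivative
import Literature.Analysis.FunctionSpaces.TorusInverseLaplacianCalculus
import Literature.Analysis.FunctionSpaces.TorusEnstrophyOrthogonality

/-!
# The log gate `releaseEnvelope_false_of_gradient_bound` (line `Sketch`, crux stmt-AnomalousDissipation-0206)

Registered stub of the line `Sketch` (duhamel-release) for the crux
`Summit.AnomalousDissipation.AnomalousDissipation.Theses.TwoAndHalfD.TwohalfdThesis`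
(stmt-AnomalousDissipation-0206): the NECESSARY CONDITION ("log gate", Batchelor) that every
design of the line's open witness `stub_releasedMixingWitness` must respect.

CONTENT. Let `v_j` be smooth divergence-free drifts on a window `[s, s + τ₀] × 𝕋²` whose first
derivatives are bounded UNIFORMLY in `j`, `‖∂ᵢv_j(t, x)‖ ≤ L`, and let `φ_j` be the classical
releases of one smooth pattern `h ≠ 0` into `v_j` with diffusivities `ν_j → 0⁺`
(`∂ₜφ_j + v_j·∇φ_j = ν_jΔφ_j` on the window, `φ_j(s) = h`;
`Torus.IsClassicalScalarTransportOn`). Then a `j`-uniform loss of a fixed fraction of `L²` energy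
on the window, `‖φ_j(s + τ₀)‖² ≤ (1 - δ)‖h‖²` for all `j` with `δ > 0`, is impossible.

PROOF. (1) Energy equality (`scalarL2Sq_add_scalarDissipation_holds`):
`‖h‖² - ‖φ_j(s+τ₀)‖² = 2ν_j ∫ₛ^{s+τ₀} ‖∇φ_j(t)‖² dt`. (2) `H¹` balance of classical passive
scalars (`hasDerivWithinAt_scalarGradNormSq`, general dimension `d`):
`d/dt ‖∇φ‖² = -2κ∫(Δφ)² + 2∫⟪v, ∇φ⟫Δφ` within the window — differentiate `∫ ∑ᵢ(∂ᵢφ)²` under the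
integral, commute `∂ₜ` and `∂ᵢ`, integrate by parts and insert the equation; the stretching
identity `∫⟪v, ∇φ⟫Δφ = -∑ᵢ∫⟪∂ᵢv, ∇φ⟫∂ᵢφ` (`integral_inner_gradient_mul_laplacian_eq`:
one more integration by parts, the term `∑ᵢ∫ ∂ᵢφ ⟪v, ∇∂ᵢφ⟫` vanishing by incompressibility)
gives `∫⟪v, ∇φ⟫Δφ ≤ (card d) L ‖∇φ‖²` (`integral_inner_gradient_mul_laplacian_le`), whence
Grönwall (`scalarGradNormSq_le_mul_exp`): `‖∇φ_j(t)‖² ≤ ‖∇h‖² exp(2 (card d) |L| (t - s))`.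
(3) Hence `δ‖h‖² ≤ 2ν_j τ₀ ‖∇h‖² e^{4|L|τ₀} → 0`, a contradiction for large `j`.
So any witness family must have `sup_j ‖∇v_j‖_{L^∞} = ∞` on the release windows
(quantitatively `‖∇v_j‖_∞ ≳ log(1/ν_j)`: the Batchelor-scale obstruction).
Supports stmt-AnomalousDissipation-0206. [folklore: Batchelor 1959; Miles–Doering,
Nonlinearity 31 (2018), §2 (`H¹` growth `‖∇θ‖ ≤ ‖∇θ₀‖e^{‖∇u‖_∞ t}` and the resulting lower
bound on mixing rates); DEIJ 2022, §1]
-/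

noncomputable section

-- the summit path `AnomalousDissipation/AnomalousDissipation` duplicates a namespace component
set_option linter.dupNamespace false

namespace Summit.AnomalousDissipation.AnomalousDissipation.Theorems.TwohalfdThesis

open MeasureTheory Set Filter Topology
open scoped ENNReal NNReal InnerProductSpace
open Literature.Analysis.FunctionSpaces Literature.Analysis.FluidPDE

section H1Balance

variable {d : Type*} [Fintype d] [DecidableEq d]

/-- **The `H¹` balance of classical passive scalars.** For a classical solution of
`∂ₜθ + u·∇θ = κΔθ`, `div u = 0` on `[a, b] × T^d`, `a < b`, and every `t ∈ [a, b]`,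
`d/dt ‖∇θ(t)‖²_{L²} = -2κ ∫ (Δθ(t))² + 2 ∫ ⟪u(t), ∇θ(t)⟫ Δθ(t)`
as a one-sided derivative within `[a, b]`: differentiate `∫ ∑ᵢ (∂ᵢθ)²` under the integral,
commute `∂ₜ` with `∂ᵢ`, integrate by parts (`∑ᵢ ∫ ∂ᵢ(∂ₜθ) ∂ᵢθ = -∫ (∂ₜθ) Δθ`) and insert the
equation `∂ₜθ = κΔθ - ⟪u, ∇θ⟫`. [folklore] -/
theorem hasDerivWithinAt_scalarGradNormSq {a b κ : ℝ} {u : ℝ → UnitAddTorus d → EuclideanSpace ℝ d}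
    {θ : ℝ → UnitAddTorus d → ℝ} (h : Torus.IsClassicalScalarTransportOn (Icc a b) κ u θ)
    (hab : a < b) {t : ℝ} (ht : t ∈ Icc a b) :
    HasDerivWithinAt (fun s => Torus.scalarGradNormSq (θ s))
      (-(2 * κ) * (∫ x, Torus.laplacian (θ t) x ^ 2) +
        2 * ∫ x, ⟪u t x, Torus.gradient (θ t) x⟫_ℝ * Torus.laplacian (θ t) x) (Icc a b) t := by
  set S : Set ℝ := Icc a b with hSdef
  have hSc : Convex ℝ S := convex_Icc a b
  have hU : UniqueDiffOn ℝ S := uniqueDiffOn_Icc hab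
  have hθs : Torus.IsSmoothSpaceTimeOn S θ := h.smooth_scalar
  have hθt : Torus.IsSmooth (θ t) := hθs.isSmooth_slice ht
  have hut : Torus.IsSmooth (u t) := h.smooth_velocity.isSmooth_slice ht
  have hA : Torus.IsSmooth (Torus.timeDerivWithin S θ t) := hθs.isSmooth_timeDerivWithin hU ht
  have hDi : ∀ i, Torus.IsSmoothSpaceTimeOn S (fun s => Torus.partialDeriv i (θ s)) :=
    fun i => hθs.partialDeriv hU i
  -- Step 1: differentiate `∫ ∑ᵢ ∂ᵢθ ∂ᵢθ` under the integral sign.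
  have hφ : Torus.IsSmoothSpaceTimeOn S
      (fun s x => ∑ i, Torus.partialDeriv i (θ s) x * Torus.partialDeriv i (θ s) x) :=
    Torus.IsSmoothSpaceTimeOn.sum fun i _ => (hDi i).mul (hDi i)
  have hE := hφ.hasDerivWithinAt_integral hSc ht
  -- Step 2: `∂ₜ ∑ᵢ ∂ᵢθ ∂ᵢθ = 2 ∑ᵢ ∂ᵢ(∂ₜθ) ∂ᵢθ`.
  have htd : ∀ x, Torus.timeDerivWithin S
      (fun s x => ∑ i, Torus.partialDeriv i (θ s) x * Torus.partialDeriv i (θ s) x) t x =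
      2 * ∑ i, Torus.partialDeriv i (Torus.timeDerivWithin S θ t) x *
        Torus.partialDeriv i (θ t) x := by
    intro x
    have hsum := HasDerivWithinAt.fun_sum (u := Finset.univ)
      (A := fun i s => Torus.partialDeriv i (θ s) x * Torus.partialDeriv i (θ s) x)
      (A' := fun i => Torus.timeDerivWithin S (fun s => Torus.partialDeriv i (θ s)) t x *
          Torus.partialDeriv i (θ t) x +
        Torus.partialDeriv i (θ t) x * Torus.timeDerivWithin S (fun s => Torus.partialDeriv i (θ s)) t x)
      (x := t) (s := S)
      fun i _ => ((hDi i).hasDerivWithinAt_slice ht x).mul ((hDi i).hasDerivWithinAt_slice ht x)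
    have h2 := hsum.derivWithin (hU t ht)
    rw [Torus.timeDerivWithin, h2, Finset.mul_sum]
    refine Finset.sum_congr rfl fun i _ => ?_
    rw [Torus.timeDerivWithin_partialDeriv_comm hab hθs ht i x]
    ring
  -- Step 3: Green, `∑ᵢ ∫ ∂ᵢ(∂ₜθ) ∂ᵢθ = -∫ (∂ₜθ) Δθ`.
  have hE' : ∫ x, Torus.timeDerivWithin S
        (fun s x => ∑ i, Torus.partialDeriv i (θ s) x * Torus.partialDeriv i (θ s) x) t x =
      -2 * ∫ x, Torus.timeDerivWithin S θ t x * Torus.laplacian (θ t) x := by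
    simp_rw [htd, integral_const_mul]
    have i1 : ∀ i, Integrable (fun x => Torus.partialDeriv i (Torus.timeDerivWithin S θ t) x *
        Torus.partialDeriv i (θ t) x) volume :=
      fun i => ((hA.partialDeriv i).smul' (hθt.partialDeriv i)).integrable
    rw [integral_finsetSum _ fun i _ => i1 i, Torus.integral_mul_laplacian_eq_neg_sum hA hθt]
    ring
  rw [hE'] at hE
  -- Step 4: the functions agree on `S`; insert the equation.
  have hfun : ∀ s ∈ S, Torus.scalarGradNormSq (θ s) =
      ∫ x, ∑ i, Torus.partialDeriv i (θ s) x * Torus.partialDeriv i (θ s) x := by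
    intro s hs
    have hθs' : Torus.IsSmooth (θ s) := hθs.isSmooth_slice hs
    have i1 : ∀ i, Integrable (fun x => Torus.partialDeriv i (θ s) x * Torus.partialDeriv i (θ s) x)
        volume := fun i => ((hθs'.partialDeriv i).smul' (hθs'.partialDeriv i)).integrable
    rw [Torus.scalarGradNormSq_eq_sum_integral hθs', integral_finsetSum _ fun i _ => i1 i]
    simp_rw [sq]
  refine (hE.congr hfun (hfun t ht)).congr_deriv ?_
  have hpt : (fun x => Torus.timeDerivWithin S θ t x * Torus.laplacian (θ t) x) =
      fun x => κ * Torus.laplacian (θ t) x ^ 2 -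
        ⟪u t x, Torus.gradient (θ t) x⟫_ℝ * Torus.laplacian (θ t) x := by
    funext x
    have := h.transport t ht x
    have hre : Torus.timeDerivWithin S θ t x =
        κ * Torus.laplacian (θ t) x - ⟪u t x, Torus.gradient (θ t) x⟫_ℝ := by linarith
    rw [hre]
    ring
  have i1 : Integrable (fun x => κ * Torus.laplacian (θ t) x ^ 2) volume :=
    ((continuous_const.mul (hθt.laplacian.continuous.pow 2))).integrable_unitAddTorus
  have i2 : Integrable (fun x => ⟪u t x, Torus.gradient (θ t) x⟫_ℝ * Torus.laplacian (θ t) x) volume :=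
    ((hut.inner hθt.gradient).smul' hθt.laplacian).integrable
  rw [hpt, integral_sub i1 i2, integral_const_mul]
  ring

/-- **The stretching identity for the scalar gradient.** For a smooth divergence-free `u` and a
smooth scalar `θ` on `T^d`,
`∫ ⟪u, ∇θ⟫ Δθ = -∑ᵢ ∫ ⟪∂ᵢu, ∇θ⟫ ∂ᵢθ`:
integrate by parts (`∫ a Δθ = -∑ᵢ ∫ ∂ᵢa ∂ᵢθ` with `a = ⟪u, ∇θ⟫`), expand
`∂ᵢ⟪u, ∇θ⟫ = ⟪u, ∇∂ᵢθ⟫ + ⟪∂ᵢu, ∇θ⟫` (`∂ᵢ∇ = ∇∂ᵢ`), and drop `∫ ∂ᵢθ ⟪u, ∇∂ᵢθ⟫ = 0`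
(incompressibility). Only the velocity GRADIENT stretches `∇θ`. [folklore] -/
theorem integral_inner_gradient_mul_laplacian_eq {u : UnitAddTorus d → EuclideanSpace ℝ d}
    {θ : UnitAddTorus d → ℝ} (hu : Torus.IsSmooth u) (hdiv : Torus.IsDivFree u)
    (hθ : Torus.IsSmooth θ) :
    ∫ x, ⟪u x, Torus.gradient θ x⟫_ℝ * Torus.laplacian θ x =
      -∑ i, ∫ x, ⟪Torus.partialDeriv i u x, Torus.gradient θ x⟫_ℝ * Torus.partialDeriv i θ x := by
  have hg : Torus.IsSmooth (Torus.gradient θ) := hθ.gradient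
  have ha : Torus.IsSmooth (fun y => ⟪u y, Torus.gradient θ y⟫_ℝ) := hu.inner hg
  rw [Torus.integral_mul_laplacian_eq_neg_sum ha hθ]
  congr 1
  refine Finset.sum_congr rfl fun i _ => ?_
  have hpt : ∀ x, Torus.partialDeriv i (fun y => ⟪u y, Torus.gradient θ y⟫_ℝ) x *
      Torus.partialDeriv i θ x =
      Torus.partialDeriv i θ x * ⟪u x, Torus.gradient (Torus.partialDeriv i θ) x⟫_ℝ +
        ⟪Torus.partialDeriv i u x, Torus.gradient θ x⟫_ℝ * Torus.partialDeriv i θ x := by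
    intro x
    rw [Torus.partialDeriv_inner (hu.isContDiff (by simp)) (hg.isContDiff (by simp)),
      CompressibleEuler.partialDeriv_gradient_eq hθ i x]
    ring
  simp_rw [hpt]
  have i1 : Integrable (fun x => Torus.partialDeriv i θ x *
      ⟪u x, Torus.gradient (Torus.partialDeriv i θ) x⟫_ℝ) volume :=
    ((hθ.partialDeriv i).smul' (hu.inner (hθ.partialDeriv i).gradient)).integrable
  have i2 : Integrable (fun x => ⟪Torus.partialDeriv i u x, Torus.gradient θ x⟫_ℝ *
      Torus.partialDeriv i θ x) volume :=
    (((hu.partialDeriv i).inner hg).smul' (hθ.partialDeriv i)).integrable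
  rw [integral_add i1 i2, Torus.integral_mul_inner_gradient_self_eq_zero hu hdiv (hθ.partialDeriv i),
    zero_add]

/-- **The stretching bound.** If all first derivatives of the smooth divergence-free drift are
bounded, `‖∂ᵢu(x)‖ ≤ L`, then `∫ ⟪u, ∇θ⟫ Δθ ≤ (card d) L ‖∇θ‖²_{L²}` for every smooth scalar `θ`
(the stretching identity, Cauchy–Schwarz `|⟪∂ᵢu, ∇θ⟫| ≤ L‖∇θ‖` and `|∂ᵢθ| ≤ ‖∇θ‖`). [folklore] -/
theorem integral_inner_gradient_mul_laplacian_le {u : UnitAddTorus d → EuclideanSpace ℝ d}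
    {θ : UnitAddTorus d → ℝ} (hu : Torus.IsSmooth u) (hdiv : Torus.IsDivFree u)
    (hθ : Torus.IsSmooth θ) {L : ℝ} (hL : ∀ i x, ‖Torus.partialDeriv i u x‖ ≤ L) :
    ∫ x, ⟪u x, Torus.gradient θ x⟫_ℝ * Torus.laplacian θ x ≤
      Fintype.card d * L * Torus.scalarGradNormSq θ := by
  have hθ1 : Torus.IsContDiff 1 θ := hθ.isContDiff (by simp)
  have hg : Torus.IsSmooth (Torus.gradient θ) := hθ.gradient
  have key : ∀ i, -(∫ x, ⟪Torus.partialDeriv i u x, Torus.gradient θ x⟫_ℝ *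
      Torus.partialDeriv i θ x) ≤ L * Torus.scalarGradNormSq θ := by
    intro i
    rw [← integral_neg, Torus.scalarGradNormSq, ← integral_const_mul]
    refine integral_mono ((((hu.partialDeriv i).inner hg).smul' (hθ.partialDeriv i)).integrable.neg)
      (hg.norm_sq.integrable.const_mul L) fun x => ?_
    have h1 : |⟪Torus.partialDeriv i u x, Torus.gradient θ x⟫_ℝ| ≤
        ‖Torus.partialDeriv i u x‖ * ‖Torus.gradient θ x‖ := abs_real_inner_le_norm _ _
    have h2 : |Torus.partialDeriv i θ x| ≤ ‖Torus.gradient θ x‖ :=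
      Torus.abs_partialDeriv_le_norm_gradient hθ1 x i
    refine (neg_le_abs _).trans ?_
    rw [abs_mul]
    calc |⟪Torus.partialDeriv i u x, Torus.gradient θ x⟫_ℝ| * |Torus.partialDeriv i θ x|
        ≤ ‖Torus.partialDeriv i u x‖ * ‖Torus.gradient θ x‖ * ‖Torus.gradient θ x‖ :=
          mul_le_mul h1 h2 (abs_nonneg _) (by positivity)
      _ ≤ L * ‖Torus.gradient θ x‖ * ‖Torus.gradient θ x‖ := by gcongr; exact hL i x
      _ = L * ‖Torus.gradient θ x‖ ^ 2 := by ring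
  rw [integral_inner_gradient_mul_laplacian_eq hu hdiv hθ, ← Finset.sum_neg_distrib]
  calc ∑ i, -(∫ x, ⟪Torus.partialDeriv i u x, Torus.gradient θ x⟫_ℝ * Torus.partialDeriv i θ x)
      ≤ ∑ _i : d, L * Torus.scalarGradNormSq θ := Finset.sum_le_sum fun i _ => key i
    _ = Fintype.card d * L * Torus.scalarGradNormSq θ := by
        rw [Finset.sum_const, Finset.card_univ, nsmul_eq_mul]
        ring

/-- **Exponential `H¹` bound for classical passive scalars with Lipschitz drift** (the estimate
behind the Batchelor scale): for a classical solution of `∂ₜθ + u·∇θ = κΔθ`, `κ ≥ 0`, on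
`[a, b] × T^d` whose drift has bounded first derivatives `‖∂ᵢu(t, x)‖ ≤ L` on the window,
`‖∇θ(t)‖²_{L²} ≤ ‖∇θ(a)‖²_{L²} · exp(2 (card d) L (t - a))` for `t ∈ [a, b]`
(the `H¹` balance, `-2κ∫(Δθ)² ≤ 0`, the stretching bound, and Grönwall's inequality in the
one-sided form `le_gronwallBound_of_liminf_deriv_right_le`). [folklore] -/
theorem scalarGradNormSq_le_mul_exp {a b κ : ℝ} {u : ℝ → UnitAddTorus d → EuclideanSpace ℝ d}
    {θ : ℝ → UnitAddTorus d → ℝ} (h : Torus.IsClassicalScalarTransportOn (Icc a b) κ u θ)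
    (hκ : 0 ≤ κ) (hab : a < b) {L : ℝ}
    (hL : ∀ t ∈ Icc a b, ∀ (i : d) (x : UnitAddTorus d), ‖Torus.partialDeriv i (u t) x‖ ≤ L)
    {t : ℝ} (ht : t ∈ Icc a b) :
    Torus.scalarGradNormSq (θ t) ≤
      Torus.scalarGradNormSq (θ a) * Real.exp (2 * Fintype.card d * L * (t - a)) := by
  set G : ℝ → ℝ := fun s => Torus.scalarGradNormSq (θ s) with hG
  set G' : ℝ → ℝ := fun s => -(2 * κ) * (∫ x, Torus.laplacian (θ s) x ^ 2) +
    2 * ∫ x, ⟪u s x, Torus.gradient (θ s) x⟫_ℝ * Torus.laplacian (θ s) x with hG'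
  have hder : ∀ s ∈ Icc a b, HasDerivWithinAt G (G' s) (Icc a b) s := fun s hs =>
    hasDerivWithinAt_scalarGradNormSq h hab hs
  have hGc : ContinuousOn G (Icc a b) := fun s hs => (hder s hs).continuousWithinAt
  have hder' : ∀ s ∈ Ico a b, HasDerivWithinAt G (G' s) (Ici s) s := fun s hs =>
    ((hder s (Ico_subset_Icc_self hs)).mono (Icc_subset_Icc hs.1 le_rfl)).mono_of_mem_nhdsWithin
      (Icc_mem_nhdsGE hs.2)
  have hbound : ∀ s ∈ Ico a b, G' s ≤ 2 * Fintype.card d * L * G s + 0 := by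
    intro s hs
    have hs' : s ∈ Icc a b := Ico_subset_Icc_self hs
    have hθs : Torus.IsSmooth (θ s) := h.smooth_scalar.isSmooth_slice hs'
    have hus : Torus.IsSmooth (u s) := h.smooth_velocity.isSmooth_slice hs'
    have hT := integral_inner_gradient_mul_laplacian_le hus (h.divFree s hs') hθs (hL s hs')
    have hvisc : 0 ≤ ∫ x, Torus.laplacian (θ s) x ^ 2 := integral_nonneg fun _ => sq_nonneg _
    simp only [hG, hG']
    nlinarith [mul_nonneg hκ hvisc, hT]
  have hgr := le_gronwallBound_of_liminf_deriv_right_le hGc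
    (fun s hs r hr => (hder' s hs).liminf_right_slope_le hr) le_rfl hbound t ht
  rw [gronwallBound_ε0] at hgr
  exact hgr

end H1Balance

/-! ## The log gate -/

/-- **The log gate (Batchelor's necessary condition) for the released-family mixing witness.**
Let `v_j` be drifts on the window `[s, s + τ₀] × 𝕋²` with `j`-UNIFORMLY bounded first
derivatives, `‖∂ᵢv_j‖ ≤ L`, and let `φ_j` be the classical releases of one smooth pattern `h`
(`∂ₜφ_j + v_j·∇φ_j = ν_jΔφ_j`, `φ_j(s) = h`) with `ν_j → 0⁺`. Then the releases cannot lose a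
fixed fraction `δ‖h‖²` of `L²`-energy on the window uniformly in `j`: by the energy equality the
deficit is `2ν_j∫ₛ^{s+τ₀}‖∇φ_j‖²`, and by the exponential `H¹` bound
`‖∇φ_j(t)‖² ≤ ‖∇h‖² e^{4|L|(t-s)}` it is `≤ 2ν_jτ₀‖∇h‖²e^{4|L|τ₀} → 0`. Hence any witness of the
line's open stub must have `sup_j ‖∇v_j‖_∞ = ∞` on the release windows (quantitatively
`‖∇v_j‖_∞ ≳ log(1/ν_j)/τ₀`). [folklore] -/
theorem releaseEnvelope_false_of_gradient_bound : ∀ (ν : ℕ → ℝ) (v : ℕ → ℝ → UnitAddTorus (Fin 2) → EuclideanSpace ℝ (Fin 2)) (h : UnitAddTorus (Fin 2) → ℝ) (φ : ℕ → ℝ → UnitAddTorus (Fin 2) → ℝ) (L s τ₀ δ : ℝ), (∀ j, 0 < ν j) → Tendsto ν atTop (𝓝 0) → Torus.IsSmooth h → 0 < Torus.scalarL2Sq h → 0 < τ₀ → 0 < δ → (∀ j, Torus.IsClassicalScalarTransportOn (Icc s (s + τ₀)) (ν j) (v j) (φ j) ∧ φ j s = h) → (∀ j, ∀ t ∈ Icc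 s (s + τ₀), ∀ (i : Fin 2) (x : UnitAddTorus (Fin 2)), ‖Torus.partialDeriv i (v j t) x‖ ≤ L) → (∀ j, Torus.scalarL2Sq (φ j (s + τ₀)) ≤ (1 - δ) * Torus.scalarL2Sq h) → False := by
  intro ν v h φ L s τ₀ δ hν hν0 _hh hh2 hτ₀ hδ hsol hL henv
  have hab : s < s + τ₀ := by linarith
  -- the `j`-uniform enstrophy budget on the window
  set C : ℝ := 2 * Fintype.card (Fin 2) * |L| with hC
  have hC0 : 0 ≤ C := by positivity
  set M : ℝ := Torus.scalarGradNormSq h * Real.exp (C * τ₀) with hM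
  have hbudget : ∀ j, δ * Torus.scalarL2Sq h ≤ ν j * (2 * τ₀ * M) := by
    intro j
    obtain ⟨hj, hj0⟩ := hsol j
    -- (1) the energy equality on the window
    have hen := Torus.IsClassicalScalarTransportOn.scalarL2Sq_add_scalarDissipation_holds hj hab.le
      Subset.rfl
    rw [hj0, Torus.scalarDissipation] at hen
    -- (2) the exponential `H¹` bound, uniformly on the window
    have hL' : ∀ t ∈ Icc s (s + τ₀), ∀ (i : Fin 2) (x : UnitAddTorus (Fin 2)),
        ‖Torus.partialDeriv i (v j t) x‖ ≤ |L| :=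
      fun t ht i x => (hL j t ht i x).trans (le_abs_self L)
    have hGle : ∀ t ∈ Icc s (s + τ₀), Torus.scalarGradNormSq (φ j t) ≤ M := by
      intro t ht
      have h1 := scalarGradNormSq_le_mul_exp hj (hν j).le hab hL' ht
      rw [hj0] at h1
      refine h1.trans (mul_le_mul_of_nonneg_left (Real.exp_le_exp.2 ?_)
        (Torus.scalarGradNormSq_nonneg h))
      exact mul_le_mul_of_nonneg_left (by linarith [ht.2]) hC0
    -- (3) integrate over the window
    have hGc : ContinuousOn (fun t => Torus.scalarGradNormSq (φ j t)) (Icc s (s + τ₀)) :=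
      hj.continuousOn_scalarGradNormSq (convex_Icc _ _) (uniqueDiffOn_Icc hab)
    have hGi : IntervalIntegrable (fun t => Torus.scalarGradNormSq (φ j t)) volume s (s + τ₀) :=
      (hGc.mono (uIcc_of_le hab.le).subset).intervalIntegrable
    have hint : ∫ t in s..(s + τ₀), Torus.scalarGradNormSq (φ j t) ≤ ∫ _t in s..(s + τ₀), M :=
      intervalIntegral.integral_mono_on hab.le hGi intervalIntegrable_const fun t ht => hGle t ht
    rw [intervalIntegral.integral_const, smul_eq_mul, add_sub_cancel_left] at hint
    have hνint := mul_le_mul_of_nonneg_left hint (hν j).le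
    nlinarith [henv j, hνint, hen]
  -- (4) `ν_j → 0`: contradiction
  have hlim : Tendsto (fun j => ν j * (2 * τ₀ * M)) atTop (𝓝 (0 * (2 * τ₀ * M))) :=
    hν0.mul_const _
  rw [zero_mul] at hlim
  obtain ⟨j, hj⟩ := (hlim.eventually_lt_const (mul_pos hδ hh2)).exists
  exact lt_irrefl _ ((hbudget j).trans_lt hj)

end Summit.AnomalousDissipation.AnomalousDissipation.Theorems.TwohalfdThesis

end
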